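import Summits.CriticalPhenomena.SAWScalingLimit.Theses.SAWRenewalTightness

/-!
# Sketch (crux-ideate, ideator 3) — first lemmas for the crux `EventualTight`
(stmt-CriticalPhenomena-1372, route SAWRenewalTightness)

Card A `kesten-chain-embedding`: column-gap crossings of a concatenation of bridges localise in
one factor (L1, deterministic, PROVED here); the band-oscillation atoms `IrrBandTame` / `ChainBandTame` and the
exact renewal reduction between them (L2); the crux's inner statement for ONE Dobrushin datum and
the left–right-extremal sub-class (L3).

Card B `length-uniform-ensembles`: the fugacity-free master statement `UniformLengthTight`
(canonical ensembles, all lengths), the mixture transfer to the crux (L4, PROVED: `UniformLengthTight → EventualTight` sorry-free),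
the dichotomy lemma (L6, PROVED) and the dilute third of the length axis (L5, provable now).

L1 (with its two vanishing lemmas), L4 and L6 are PROVED (no sorry); the remaining two `sorry`s (L2, L5) mark statements that only have to elaborate.
-/

noncomputable section

open Set Filter Topology MeasureTheory ProbabilityTheory
open scoped ENNReal
open Literature.Probability.RandomPlanarGeometry Literature.Probability.LatticeModels
open Literature.Probability.RandomPlanarGeometry.SAW

namespace Summit.CriticalPhenomena.SAWScalingLimit.Cruxes.EventualTight.Ideator3

open Summit.CriticalPhenomena.SAWScalingLimit.Theses.SAWRenewalTightness

/-! ## Card A — L1: crossings of a concatenation of bridges localise in one factor -/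

/-- Additivity of gap crossings under concatenation (any words): steps of `s ++ t` across the gap
`{h, h+1}` are those of `s` across it plus those of `t` across the shifted gap `{h - span s, …}`.
PROVED. [folklore] -/
theorem crossings_append (s t : List Step) (h : ℤ) :
    crossings (s ++ t) h = crossings s h + crossings t (h - xEnd s) := by
  unfold crossings
  rw [List.length_append, List.range_add, List.filter_append, List.length_append, List.filter_map,
    List.length_map]
  congr 1
  · apply congrArg
    apply List.filter_congr
    intro i hi
    rw [List.mem_range] at hi
    rw [xAt_append_left s t hi.le, xAt_append_left s t hi]
  · apply congrArg
    apply List.filter_congr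
    intro j hj
    have e1 : xAt (s ++ t) (s.length + j) = xEnd s + xAt t j := xAt_append_right s t j
    have e2 : xAt (s ++ t) (s.length + j + 1) = xEnd s + xAt t (j + 1) := by
      rw [Nat.add_assoc]; exact xAt_append_right s t (j + 1)
    simp only [Function.comp_apply, e1, e2, decide_eq_decide]
    constructor
    · rintro (⟨h1, h2⟩ | ⟨h1, h2⟩)
      · left; constructor <;> omega
      · right; constructor <;> omega
    · rintro (⟨h1, h2⟩ | ⟨h1, h2⟩)
      · left; constructor <;> omega
      · right; constructor <;> omega

/-- A bridge word does not cross gaps at or beyond its span. PROVED. [folklore] -/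
theorem crossings_eq_zero_of_xEnd_le {s : List Step} (hs : IsBridgeW s) {h : ℤ} (hh : xEnd s ≤ h) :
    crossings s h = 0 := by
  unfold crossings
  rw [List.length_eq_zero_iff, List.filter_eq_nil_iff]
  intro i hi
  have h1 := hs.xAt_le i
  have h2 := hs.xAt_le (i + 1)
  simp only [decide_eq_true_eq]
  omega

/-- A bridge word does not cross gaps left of its start. PROVED. [folklore] -/
theorem crossings_eq_zero_of_neg {t : List Step} (ht : IsBridgeW t) {g : ℤ} (hg : g < 0) :
    crossings t g = 0 := by
  unfold crossings
  rw [List.length_eq_zero_iff, List.filter_eq_nil_iff]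
  intro i hi
  rw [List.mem_range] at hi
  have h1 : 0 ≤ xAt t i := by
    rcases Nat.eq_zero_or_pos i with rfl | hi0
    · simp
    · exact ((isBridgeW_iff t).1 ht i hi0 hi.le).1.le
  have h2 : 0 < xAt t (i + 1) := ((isBridgeW_iff t).1 ht (i + 1) (by omega) hi).1
  simp only [decide_eq_true_eq]
  omega

/-- **L1 (deterministic localisation), PROVED.** For bridge words `s`, `t` (first-coordinate bridges
of `SAWWordBridges.lean`) and any column gap `{h, h+1}`: the steps of `s ++ t` across the gap all
belong to `s` if `h < span s` and all belong to `t` otherwise (a bridge never revisits a column at or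
left of its start and never exceeds its span). Hence, along Kesten's chain `β₁ β₂ ⋯` of irreducible
bridges, every column gap is crossed inside exactly ONE irreducible factor, and a band of gaps each
crossed `≥ 3` times lies inside one factor. -/
theorem crossings_append_of_isBridgeW {s t : List Step} (hs : IsBridgeW s) (ht : IsBridgeW t) (h : ℤ) :
    crossings (s ++ t) h = if h < xEnd s then crossings s h else crossings t (h - xEnd s) := by
  rw [crossings_append]
  split_ifs with hlt
  · rw [crossings_eq_zero_of_neg ht (by omega), Nat.add_zero]
  · rw [crossings_eq_zero_of_xEnd_le hs (by omega), Nat.zero_add]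

/-! ## Card A — L2: the band-oscillation atoms and the exact renewal reduction -/

/-- The band of column gaps `{h,h+1}`, `c ≤ h < c + w`, is `k`-oscillated by the word `v`: every
gap of the band is crossed at least `2k+1` times. (A `k`-fold down–up oscillation of a bridge
across the whole band forces this.) -/
def BandOsc (k : ℕ) (c w : ℤ) (v : List Step) : Prop :=
  ∀ h : ℤ, c ≤ h → h < c + w → 2 * k + 1 ≤ crossings v h

/-- Bridges **irreducible above column `m`** (Dyhr–Gilbert–Kennedy–Lawler–Passon 2011, before
Def. 3: the class `𝓘_m`): self-avoiding non-empty bridge words of span `≥ m` all of whose break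
points lie strictly below column `m`. Under Kesten's identity `Σ_irr x_c^{|β|} = 1` the weights
`x_c^{|v|}` form a PROBABILITY law `Q_m` on this class (DGKLP Def. 3: "generate i.i.d. irreducible
bridges and stop when the height of their concatenation is at least m"). -/
def IrrAbove (m : ℤ) (v : List Step) : Prop :=
  IsSAW v ∧ IsBridgeW v ∧ v ≠ [] ∧ m ≤ xEnd v ∧ ∀ j, IsBreak v j → xAt v j < m

/-- Tail mass of Kesten's irreducible span law: `Σ_{β irreducible, span β ≥ m} x_c^{|β|}`
(`≤ 1`, the probability that one irreducible bridge of the chain has span `≥ m`). -/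
def irrTailMass (m : ℤ) : ℝ :=
  ∑' v : {v : List Step // IsIrrBridge v ∧ m ≤ xEnd v}, criticalFugacity ^ v.1.length

/-- **Atom A2 `IrrBandTame` (intra-irreducible-bridge band tameness).** For every `ε > 0` there is
`k` such that, for every band `[c, c+w)` (`c ≥ 0`, `w ≥ 1`), the `x_c`-mass of irreducible bridges
that reach beyond the band AND `k`-oscillate it is at most `ε` times the mass of irreducible
bridges that merely reach beyond it — uniformly in `c, w` (no rate, no exponent; a conditional
probability under Kesten's irreducible-bridge law `Q`). -/
def IrrBandTame : Prop :=
  ∀ ε : ℝ, 0 < ε → ∃ k : ℕ, ∀ (c w : ℤ), 0 ≤ c → 1 ≤ w →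
    ∀ F : Finset (List Step), (∀ v ∈ F, IsIrrBridge v ∧ c + w ≤ xEnd v ∧ BandOsc k c w v) →
      ∑ v ∈ F, criticalFugacity ^ v.length ≤ ε * irrTailMass (c + w)

/-- **`ChainBandTame` (band tameness of Kesten's half-plane walk).** Under `Q_{c+w}` (bridges
irreducible above the far edge of the band, weight `x_c^{|v|}` — a probability law by Kesten's
identity) the probability that the band `[c, c+w)` is `k`-oscillated is `≤ ε`, uniformly in the
band. This is the chain-world form of per-shell tightness in the direction of the renewal. -/
def ChainBandTame : Prop :=
  ∀ ε : ℝ, 0 < ε → ∃ k : ℕ, ∀ (c w : ℤ), 0 ≤ c → 1 ≤ w →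
    ∀ F : Finset (List Step), (∀ v ∈ F, IrrAbove (c + w) v ∧ BandOsc k c w v) →
      ∑ v ∈ F, criticalFugacity ^ v.length ≤ ε

/-- **L2 (exact renewal reduction, provable given `KestenIdentity`).** A bridge irreducible above
`c+w` factors uniquely as `β₁ ⋯ β_J` with junction columns `g_0 = 0 < g_1 < ⋯ < g_{J-1} < c+w ≤ g_J`;
by L1 a `k`-oscillated band (k ≥ 1) contains no junction column and lies inside the last factor
`β_J`, which starts at column `g = g_{J-1} ≤ c`. Summing over the prefix (renewal mass `u_g ≤ 1`,
`StripMassConservation`) gives the EXACT convolution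
`Q_{c+w}[band k-oscillated] = Σ_{g ≤ c} u_g · q_k(c-g, w)` with `q_k(t,w)` the mass of irreducible
bridges `k`-oscillating the shifted band `[t, t+w)`; `IrrBandTame` bounds `q_k ≤ ε q_0` termwise and
`Σ_g u_g q_0(c-g,w) = Q_{c+w}[no junction in the band] ≤ 1`. -/
theorem chainBandTame_of_irrBandTame (hK : KestenIdentity) (h : IrrBandTame) : ChainBandTame := by
  sorry

/-- **Atom A2⁺ `IrrBandTamePinned` (pinned form; absorbs the endpoint pin).** The same band tameness
for irreducible bridges with a PRESCRIBED endpoint `e` (a ratio of two point-to-point irreducible-bridge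
masses with the same pin). Decomposing the pinned chain at the first junction column past the band
writes `P[band k-oscillated ∣ pinned at b_δ]` as a tilted average over the junction's lateral position of
exactly these conditional probabilities, so the pinned atom makes the prescribed lattice endpoint of the
crux harmless with NO Harnack-type input. -/
def IrrBandTamePinned : Prop :=
  ∀ ε : ℝ, 0 < ε → ∃ k : ℕ, ∀ (c w : ℤ), 0 ≤ c → 1 ≤ w → ∀ e : Site 2, c + w ≤ e 0 →
    ∀ F : Finset (List Step), (∀ v ∈ F, IsIrrBridge v ∧ wEnd v = e ∧ BandOsc k c w v) →
      ∑ v ∈ F, criticalFugacity ^ v.length ≤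
        ε * ∑' v : {v : List Step // IsIrrBridge v ∧ wEnd v = e}, criticalFugacity ^ v.1.length

/-! ## Card A — L3: the crux per datum, and the left–right-extremal class -/

/-- The crux's inner statement for ONE Dobrushin datum `(D; a_δ, b_δ)`. -/
def EventualTightFor (D : DobrushinDomain) (a b : ℝ → Site 2) : Prop :=
  ∃ δ₀ : ℝ, 0 < δ₀ ∧ IsTightMeasureSet ((fun δ => (SAW.law D.carrier δ (a δ) (b δ)).map
    (fun γ => γ.curve)) '' Set.Ioc 0 δ₀)

/-- Sanity: the crux is the conjunction of its per-datum statements. -/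
theorem eventualTight_iff : EventualTight ↔
    ∀ (D : DobrushinDomain) (a b : ℝ → Site 2), IsEndpointApprox D a b → EventualTightFor D a b :=
  Iff.rfl

/-- **Left–right-extremal Dobrushin data**: `Ω` lies in the vertical strip `0 < re z < T` and its
marked points sit on the two boundary lines (`a` leftmost, `b` rightmost). For such data every
walk of `Ω_δ` between the last visit of its minimal column and the first later visit of its maximal
column is a BRIDGE in the sense of `SAWWordBridges.lean`, and (Dyhr–Gilbert–Kennedy–Lawler–Passon
2011, Prop. 2.10, restricted to `Ω ⊆ strip`) its `x_c`-law given the two microscopic end pieces is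
Kesten's i.i.d. irreducible-bridge chain conditioned on a cylinder event. -/
def IsLeftRightExtremal (D : DobrushinDomain) (T : ℝ) : Prop :=
  0 < T ∧ D.carrier ⊆ {z : ℂ | 0 < z.re ∧ z.re < T} ∧ (D.pt 0).re = 0 ∧ (D.pt 1).re = T

/-- The crux restricted to left–right-extremal data (the class the chain embedding reaches
directly; general data are reduced to extremal SLIT data by conditioning on the pieces before the
last column-minimum and after the first column-maximum — configurational exactness). -/
def ExtremalEventualTight : Prop :=
  ∀ (D : DobrushinDomain) (T : ℝ) (a b : ℝ → Site 2), IsLeftRightExtremal D T →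
    IsEndpointApprox D a b → EventualTightFor D a b

/-- Trivial direction (the extremal class is a sub-family of the crux). -/
theorem extremalEventualTight_of_eventualTight (h : EventualTight) : ExtremalEventualTight :=
  fun D _T a b _ hab => h D a b hab

/-! ## Card B — L4/L5: fugacity-free canonical ensembles -/

/-- **`UniformLengthTight` (the fugacity-free master statement).** For every Dobrushin datum
there is `δ₀ > 0` such that the CANONICAL ensembles — the critical law conditioned on the length
`|γ| = n`, i.e. the UNIFORM measure on `n`-step self-avoiding walks of `Ω_δ` from `a_δ` to `b_δ`
(the same for every fugacity `x > 0`; junk `0` when there is no such walk) — pushed to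
`CurveClass ℂ`, form ONE tight family over all `δ ∈ (0, δ₀]` and ALL lengths `n`. -/
def UniformLengthTight : Prop :=
  ∀ (D : DobrushinDomain) (a b : ℝ → Site 2), IsEndpointApprox D a b → ∃ δ₀ : ℝ, 0 < δ₀ ∧
    IsTightMeasureSet ((fun p : ℝ × ℕ =>
      ((SAW.law D.carrier p.1 (a p.1) (b p.1))[|{γ | γ.length = p.2}]).map (fun γ => γ.curve)) ''
        (Set.Ioc 0 δ₀ ×ˢ Set.univ))

/-- The total mass of the critical SAW law is at most one (it is `1` or the junk `0`). -/
theorem law_univ_le_one (Ω : Set ℂ) (δ : ℝ) (a b : Site 2) : SAW.law Ω δ a b Set.univ ≤ 1 := by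
  rw [SAW.law, Measure.smul_apply, smul_eq_mul]
  exact ENNReal.inv_mul_le_one _

/-- **L4 (mixture transfer), PROVED.** The critical law is the countable mixture
`Σ_n P_δ(|γ| = n) · P_δ(· ∣ |γ| = n)` of its canonical ensembles; a mixture of members of a tight
family with total weight `≤ 1` is within the same `ε` of the same compact set. Sorry-free: the typed
master statement `UniformLengthTight` implies the crux `EventualTight` BY NAME. -/
theorem eventualTight_of_uniformLengthTight (h : UniformLengthTight) : EventualTight := by
  intro D a b hab
  obtain ⟨δ₀, hδ₀, hT⟩ := h D a b hab
  refine ⟨δ₀, hδ₀, ?_⟩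
  rw [isTightMeasureSet_iff_exists_isCompact_measure_compl_le] at hT ⊢
  intro ε hε
  obtain ⟨K, hK, hKε⟩ := hT ε hε
  refine ⟨K, hK, ?_⟩
  rintro _ ⟨δ, hδ, rfl⟩
  set μ := SAW.law D.carrier δ (a δ) (b δ) with hμ
  have hmeasK : MeasurableSet Kᶜ := hK.isClosed.measurableSet.compl
  have hmf : Measurable (fun γ : DomainSAW D.carrier δ (a δ) (b δ) => γ.curve) :=
    DomainSAW.measurable_of_top _
  rw [Measure.map_apply hmf hmeasK]
  set S := (fun γ : DomainSAW D.carrier δ (a δ) (b δ) => γ.curve) ⁻¹' Kᶜ with hS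
  set L : ℕ → Set (DomainSAW D.carrier δ (a δ) (b δ)) := fun n => {γ | γ.length = n} with hL
  -- each conditioned piece is small
  have hpiece : ∀ n, μ (L n ∩ S) ≤ ε * μ (L n) := by
    intro n
    by_cases h0 : μ (L n) = 0
    · have : μ (L n ∩ S) ≤ μ (L n) := measure_mono Set.inter_subset_left
      rw [h0] at this
      rw [h0, nonpos_iff_eq_zero.1 this]
      simp
    · have htop : μ (L n) ≠ ⊤ :=
        ((measure_mono (Set.subset_univ _)).trans (law_univ_le_one _ _ _ _)).trans_lt
          ENNReal.one_lt_top |>.ne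
      have hc : (μ[|L n]).map (fun γ => γ.curve) Kᶜ ≤ ε :=
        hKε _ ⟨(δ, n), ⟨hδ, Set.mem_univ _⟩, rfl⟩
      rw [Measure.map_apply hmf hmeasK, ProbabilityTheory.cond_apply MeasurableSpace.measurableSet_top]
        at hc
      calc μ (L n ∩ S) = μ (L n) * ((μ (L n))⁻¹ * μ (L n ∩ S)) := by
            rw [← mul_assoc, ENNReal.mul_inv_cancel h0 htop, one_mul]
        _ ≤ μ (L n) * ε := by gcongr
        _ = ε * μ (L n) := mul_comm _ _
  -- decompose S along the length
  have hSU : S = ⋃ n, (L n ∩ S) := by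
    ext γ
    simp only [Set.mem_iUnion, Set.mem_inter_iff, hL, Set.mem_setOf_eq]
    exact ⟨fun hγ => ⟨γ.length, rfl, hγ⟩, fun ⟨_, _, hγ⟩ => hγ⟩
  have hdisj : Pairwise (Function.onFun Disjoint fun n => L n ∩ S) := by
    intro m n hmn
    rw [Function.onFun, Set.disjoint_left]
    rintro γ ⟨hm, -⟩ ⟨hn, -⟩
    exact hmn (hm.symm.trans hn)
  have hLU : (⋃ n, L n) = Set.univ := by
    ext γ; simp [hL]
  have hdisjL : Pairwise (Function.onFun Disjoint L) := by
    intro m n hmn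
    rw [Function.onFun, Set.disjoint_left]
    rintro γ hm hn
    exact hmn ((show γ.length = m from hm).symm.trans hn)
  calc μ S = μ (⋃ n, (L n ∩ S)) := by rw [← hSU]
    _ = ∑' n, μ (L n ∩ S) :=
        measure_iUnion hdisj fun _ => MeasurableSpace.measurableSet_top
    _ ≤ ∑' n, ε * μ (L n) := ENNReal.tsum_le_tsum hpiece
    _ = ε * ∑' n, μ (L n) := ENNReal.tsum_mul_left
    _ = ε * μ Set.univ := by
        rw [← measure_iUnion hdisjL fun _ => MeasurableSpace.measurableSet_top, hLU]
    _ ≤ ε * 1 := by gcongr; exact law_univ_le_one _ _ _ _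
    _ = ε := mul_one ε


/-- **L6 (dichotomy lemma), PROVED.** Tightness survives conditioning on events of probability
`≥ p`: if the crux holds for a datum then, for every density `c > 0` and floor `p > 0`, the critical laws
CONDITIONED ON BEING DENSE (`|γ| ≥ c/δ²`), over those meshes at which density has probability `≥ p`,
form a tight family. Contrapositive (the dichotomy of card B): if dense self-avoiding walks of `Ω_δ`
between `a_δ, b_δ` oscillate unboundedly with non-negligible probability of being dense, the crux
fails; so the crux FORCES "dense ensembles tame OR density negligible" (`P_δ(|γ| ≥ c/δ²) → 0`, a weak
form of Duminil-Copin–Kozma–Yadin's Problem 10). -/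
theorem denseConditioned_tight_of_eventualTightFor {D : DobrushinDomain} {a b : ℝ → Site 2}
    (h : EventualTightFor D a b) (c p : ℝ) (_hc : 0 < c) (hp : 0 < p) :
    ∃ δ₀ : ℝ, 0 < δ₀ ∧ IsTightMeasureSet ((fun δ =>
      ((SAW.law D.carrier δ (a δ) (b δ))[|{γ | c / δ ^ 2 ≤ (γ.length : ℝ)}]).map (fun γ => γ.curve)) ''
        {δ : ℝ | δ ∈ Set.Ioc 0 δ₀ ∧ ENNReal.ofReal p ≤
          SAW.law D.carrier δ (a δ) (b δ) {γ | c / δ ^ 2 ≤ (γ.length : ℝ)}}) := by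
  obtain ⟨δ₀, hδ₀, hT⟩ := h
  refine ⟨δ₀, hδ₀, ?_⟩
  rw [isTightMeasureSet_iff_exists_isCompact_measure_compl_le] at hT ⊢
  intro ε hε
  have hp' : 0 < ENNReal.ofReal p := ENNReal.ofReal_pos.2 hp
  have hεp : 0 < ε * ENNReal.ofReal p := ENNReal.mul_pos hε.ne' hp'.ne'
  obtain ⟨K, hK, hKε⟩ := hT (ε * ENNReal.ofReal p) hεp
  refine ⟨K, hK, ?_⟩
  rintro _ ⟨δ, ⟨hδ, hpδ⟩, rfl⟩
  have base : (SAW.law D.carrier δ (a δ) (b δ)).map (fun γ => γ.curve) Kᶜ ≤ ε * ENNReal.ofReal p :=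
    hKε _ ⟨δ, hδ, rfl⟩
  set μ := SAW.law D.carrier δ (a δ) (b δ) with hμ
  set A : Set (DomainSAW D.carrier δ (a δ) (b δ)) := {γ | c / δ ^ 2 ≤ (γ.length : ℝ)} with hA
  have hmeasK : MeasurableSet Kᶜ := hK.isClosed.measurableSet.compl
  have hmf : Measurable (fun γ : DomainSAW D.carrier δ (a δ) (b δ) => γ.curve) :=
    DomainSAW.measurable_of_top _
  rw [Measure.map_apply hmf hmeasK] at base ⊢
  rw [ProbabilityTheory.cond_apply MeasurableSpace.measurableSet_top]
  have hA0 : μ A ≠ 0 := (hp'.trans_le hpδ).ne'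
  calc (μ A)⁻¹ * μ (A ∩ (fun γ => γ.curve) ⁻¹' Kᶜ)
      ≤ (ENNReal.ofReal p)⁻¹ * μ ((fun γ => γ.curve) ⁻¹' Kᶜ) := by
        gcongr
        · exact Set.inter_subset_right
    _ ≤ (ENNReal.ofReal p)⁻¹ * (ε * ENNReal.ofReal p) := by gcongr
    _ = ε := by
        rw [mul_comm ε, ← mul_assoc, ENNReal.inv_mul_cancel hp'.ne' ENNReal.ofReal_ne_top, one_mul]


/-- **L5 (the dilute third of the length axis, provable now).** Canonical ensembles of length
`n ≤ C/δ` are tight with NO input: a lattice polyline of `≤ C/δ` steps of size `δ` has Euclidean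
length `≤ C`, hence tortuosity `M(γ, ℓ) ≤ C/ℓ + 1` at every scale `ℓ`
(`Curve.tortuosity`, `CurveClass.isCompact_closure_image_mk_of_tortuosity_le`). -/
theorem dilute_uniformLengthTight (D : DobrushinDomain) (a b : ℝ → Site 2)
    (hab : IsEndpointApprox D a b) (C : ℝ) :
    ∃ δ₀ : ℝ, 0 < δ₀ ∧ IsTightMeasureSet ((fun p : ℝ × ℕ =>
      ((SAW.law D.carrier p.1 (a p.1) (b p.1))[|{γ | γ.length = p.2}]).map (fun γ => γ.curve)) ''
        {p : ℝ × ℕ | p.1 ∈ Set.Ioc 0 δ₀ ∧ (p.2 : ℝ) * p.1 ≤ C}) := by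
  sorry

end Summit.CriticalPhenomena.SAWScalingLimit.Cruxes.EventualTight.Ideator3
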